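import Mathlib
import HarnessLib
import Summits.HubbardSuperconductivity.HubbardSuperconductivity.Theorems.KLProgrammeC4aCausticTransport
import Summits.HubbardSuperconductivity.HubbardSuperconductivity.Theorems.KLProgrammeC4aCausticTransportDefs

/-!
# Route `KLProgramme` — crux C4a, S3 brick (B4): the ITERATED caustic transport identity `∂_θᵏ ∫_a^b w(θ,ϑ)•g(d(θ,ϑ)) dϑ = ∫_a^b (T_qᵏ w)(θ,ϑ)•g(d(θ,ϑ)) dϑ`
# — every order, `g ∈ C¹` only: NO derivative ever lands on the cusp profile

Cell `gate-hubbard-kl`, seat hubbard-kl-k3c3-p3 (g39; row «implicit-function / monotonicity route for μ(n)»).  Located brick for the (C)-closer lane / the `M_k` assembly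
(stub (C) `stub_twoLeg_curvature` of `KLRegimeEngineV17F2`, stmt-HubbardSuperconductivity-20437), memo HOME/hubbard-kl-k3c3-p3/K2-FIRST-STEP.md §4/§5(c); pen (R559):
architecture word (γ) = the SIGNED first-scales tube theorem; this is its generic engine (companion of `…C4aCausticTransport` (one step) and `…C4aCausticTransportDefs`
(`transportOp q w = ∂_θw − ∂_ϑ(q·w)`)).
* §1 CLASS: `contDiff_transportOp` (`w, q ∈ C^{m+1}` jointly ⟹ `T_q w ∈ C^m` jointly — the operator in Fréchet-slice form), `contDiff_iterate_transportOp`;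
* §2 **`iteratedDeriv_intervalIntegral_smul_comp_transport`** (HEADLINE): `w, q ∈ C^k` jointly, `w ≡ 0` off a sub-window `(a′,b′) ⋐ (a,b)` for every `θ`, `d ∈ C¹` jointly with the
  transport relation `∂_θd = q·∂_ϑd` on the strip `ℝ × [a,b]`, `g ∈ C¹` ⟹ `iteratedDeriv k (θ ↦ ∫_a^b w(θ,ϑ)•g(d(θ,ϑ)) dϑ) θ = ∫_a^b (T_qᵏ w)(θ,ϑ)•g(d(θ,ϑ)) dϑ` for EVERY `k`
  (induction over the one-step identity; the class of §1 is what the induction threads);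
* **`norm_iteratedDeriv_intervalIntegral_smul_comp_transport_le`**: `‖∂_θᵏ ∫ w•g(d)‖ ≤ sup_{[a,b]}|T_qᵏ w(θ,·)| · ∫_a^b ‖g(d(θ,ϑ))‖dϑ` — at a Λ-rounded √-cusp `g` the right side is
  `n`-free at every order, where the |·|-inside dominators grow like `Λ^{3/2−k}` (K2-FIRST-STEP §2).
Carrier-free (`w q d : ℝ → ℝ → ℝ`, `g : ℝ → E`); Mathlib + the two companions; nothing is asserted about the Hubbard model, (C), K3 or superconductivity.
References: FST II CPAM 51 (1998) §3 [cite: FeldmanSalmhoferTrubowitz1998]; BGM 2006 §2.4 [cite: BenfattoGiulianiMastropietro2006]; Hörmander ALPDO I Thm 1.1.8.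
-/

noncomputable section

namespace Summit.HubbardSuperconductivity.HubbardSuperconductivity.Theorems.C4a

set_option linter.dupNamespace false -- summit = problem name (single-conjunct summit), D-0017

open Real Set Filter MeasureTheory intervalIntegral Metric
open scoped Topology Interval

variable {E : Type*} [NormedAddCommGroup E] [NormedSpace ℝ E] [CompleteSpace E]

/-! ## §1 The class `{jointly C^m, ≡ 0 off (a′,b′)}` is stable under `T_q` -/

section Class

variable {q w : ℝ → ℝ → ℝ}

/-- **`T_q w` in Fréchet-slice form**: `T_q w (θ,ϑ) = D W(θ,ϑ)(1,0) − D(QW)(θ,ϑ)(0,1)` for `W = uncurry w`, `QW = uncurry (q·w)` differentiable. [folklore] -/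
theorem transportOp_eq_fderiv (hw : Differentiable ℝ fun p : ℝ × ℝ => w p.1 p.2) (hqw : Differentiable ℝ fun p : ℝ × ℝ => q p.1 p.2 * w p.1 p.2) (θ ϑ : ℝ) :
    transportOp q w θ ϑ = fderiv ℝ (fun p : ℝ × ℝ => w p.1 p.2) (θ, ϑ) ((1 : ℝ), (0 : ℝ)) -
      fderiv ℝ (fun p : ℝ × ℝ => q p.1 p.2 * w p.1 p.2) (θ, ϑ) ((0 : ℝ), (1 : ℝ)) := by
  rw [transportOp_apply, (hasDerivAt_curry_left (hw (θ, ϑ))).deriv, (hasDerivAt_curry_right (hqw (θ, ϑ))).deriv]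

/-- **CLASS STABILITY**: `w, q` jointly `C^{m+1}` ⟹ `T_q w` jointly `C^m`. [folklore] -/
theorem contDiff_transportOp {m : ℕ} (hw : ContDiff ℝ (m + 1) fun p : ℝ × ℝ => w p.1 p.2) (hq : ContDiff ℝ (m + 1) fun p : ℝ × ℝ => q p.1 p.2) :
    ContDiff ℝ m fun p : ℝ × ℝ => transportOp q w p.1 p.2 := by
  have hqw : ContDiff ℝ (m + 1) fun p : ℝ × ℝ => q p.1 p.2 * w p.1 p.2 := hq.mul hw
  have h1 : ContDiff ℝ m fun p : ℝ × ℝ => fderiv ℝ (fun p : ℝ × ℝ => w p.1 p.2) p ((1 : ℝ), (0 : ℝ)) :=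
    (hw.fderiv_right le_rfl).clm_apply contDiff_const
  have h2 : ContDiff ℝ m fun p : ℝ × ℝ => fderiv ℝ (fun p : ℝ × ℝ => q p.1 p.2 * w p.1 p.2) p ((0 : ℝ), (1 : ℝ)) :=
    (hqw.fderiv_right le_rfl).clm_apply contDiff_const
  have hm1 : ((m : WithTop ℕ∞) + 1) ≠ 0 := by simp
  have hfun : (fun p : ℝ × ℝ => transportOp q w p.1 p.2) = fun p : ℝ × ℝ =>
      fderiv ℝ (fun p : ℝ × ℝ => w p.1 p.2) p ((1 : ℝ), (0 : ℝ)) - fderiv ℝ (fun p : ℝ × ℝ => q p.1 p.2 * w p.1 p.2) p ((0 : ℝ), (1 : ℝ)) :=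
    funext fun p => transportOp_eq_fderiv (hw.differentiable hm1) (hqw.differentiable hm1) p.1 p.2
  rw [hfun]
  exact h1.sub h2

/-- The iterates: `w, q` jointly `C^{m+k}` ⟹ `T_qᵏ w` jointly `C^m`. [folklore] -/
theorem contDiff_iterate_transportOp {m k : ℕ} (hw : ContDiff ℝ ((m + k : ℕ) : WithTop ℕ∞) fun p : ℝ × ℝ => w p.1 p.2)
    (hq : ContDiff ℝ ((m + k : ℕ) : WithTop ℕ∞) fun p : ℝ × ℝ => q p.1 p.2) :
    ContDiff ℝ m fun p : ℝ × ℝ => (transportOp q)^[k] w p.1 p.2 := by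
  induction k generalizing w m with
  | zero => simpa using hw
  | succ k ih =>
    -- `T^{k+1} w = T^k (T w)` with `T w ∈ C^{m+k}`
    have hcast : ((m + (k + 1) : ℕ) : WithTop ℕ∞) = ((m + k : ℕ) : WithTop ℕ∞) + 1 := by push_cast; ring
    have hw' : ContDiff ℝ (((m + k : ℕ) : WithTop ℕ∞) + 1) fun p : ℝ × ℝ => w p.1 p.2 := by rw [← hcast]; exact hw
    have hq' : ContDiff ℝ (((m + k : ℕ) : WithTop ℕ∞) + 1) fun p : ℝ × ℝ => q p.1 p.2 := by rw [← hcast]; exact hq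
    have hT : ContDiff ℝ ((m + k : ℕ) : WithTop ℕ∞) fun p : ℝ × ℝ => transportOp q w p.1 p.2 := contDiff_transportOp hw' hq'
    have hqk : ContDiff ℝ ((m + k : ℕ) : WithTop ℕ∞) fun p : ℝ × ℝ => q p.1 p.2 := hq'.of_le (by simp)
    have h := ih hT hqk
    simpa only [Function.iterate_succ_apply] using h

end Class

/-! ## §2 The iterated identity and the bound -/

section Iterated

variable {q d : ℝ → ℝ → ℝ} {a b a' b' : ℝ}

/-- **THE ITERATED CAUSTIC TRANSPORT IDENTITY** (HEADLINE).  `a < a′`, `b′ < b`, `a ≤ b`; `w, q` jointly `Cᵏ`; `w(θ,ϑ) = 0` for all `θ` and all `ϑ ∉ (a′,b′)`; `d` jointly `C¹`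
with the transport relation `∂_θ d(θ,ϑ) = q(θ,ϑ)·∂_ϑ d(θ,ϑ)` on `ℝ × [a,b]`; `g ∈ C¹` ⟹ for every `θ`
`iteratedDeriv k (θ ↦ ∫_a^b w(θ,ϑ)•g(d(θ,ϑ)) dϑ) θ = ∫_a^b (T_qᵏ w)(θ,ϑ)•g(d(θ,ϑ)) dϑ`. [folklore] -/
theorem iteratedDeriv_intervalIntegral_smul_comp_transport (k : ℕ) (haa' : a < a') (hbb' : b' < b) (hab : a ≤ b)
    {w : ℝ → ℝ → ℝ} (hw : ContDiff ℝ k fun p : ℝ × ℝ => w p.1 p.2) (hq : ContDiff ℝ k fun p : ℝ × ℝ => q p.1 p.2)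
    (hzero : ∀ θ, ∀ ϑ ∉ Ioo a' b', w θ ϑ = 0) (hd : ContDiff ℝ 1 fun p : ℝ × ℝ => d p.1 p.2)
    (hrel : ∀ θ, ∀ ϑ ∈ Icc a b, deriv (fun t : ℝ => d t ϑ) θ = q θ ϑ * deriv (d θ) ϑ)
    {g : ℝ → E} (hg : ContDiff ℝ 1 g) (θ : ℝ) :
    iteratedDeriv k (fun θ : ℝ => ∫ ϑ in a..b, w θ ϑ • g (d θ ϑ)) θ = ∫ ϑ in a..b, (transportOp q)^[k] w θ ϑ • g (d θ ϑ) := by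
  induction k generalizing w θ with
  | zero => simp
  | succ k ih =>
    -- one transport step at every base angle
    have hk1 : ((k + 1 : ℕ) : WithTop ℕ∞) ≠ 0 := by simp
    have hw1 : ContDiff ℝ 1 fun p : ℝ × ℝ => w p.1 p.2 := hw.of_le (by exact_mod_cast (by omega : 1 ≤ k + 1))
    have hsupp : ∀ θ', tsupport (w θ') ⊆ Ioo a b := fun θ' =>
      (tsupport_iterate_transportOp_subset (q := q) hzero 0 θ').trans (Icc_subset_Ioo haa' hbb')
    have hqθ : ∀ θ', ContDiff ℝ 1 (q θ') := fun θ' =>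
      (hq.comp (contDiff_const.prodMk contDiff_id)).of_le (by exact_mod_cast (by omega : 1 ≤ k + 1))
    have hstep : deriv (fun θ : ℝ => ∫ ϑ in a..b, w θ ϑ • g (d θ ϑ)) = fun θ' => ∫ ϑ in a..b, transportOp q w θ' ϑ • g (d θ' ϑ) := by
      funext θ'
      have h := (hasDerivAt_intervalIntegral_smul_comp_transport hab hw1 hd (hqθ θ') (hsupp θ') (fun ϑ hϑ _ => hrel θ' ϑ hϑ) hg).deriv
      rw [h]
      rfl
    -- induction hypothesis for the transported weight
    have hcast : (((k + 1 : ℕ)) : WithTop ℕ∞) = ((k : ℕ) : WithTop ℕ∞) + 1 := by push_cast; rfl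
    have hwc : ContDiff ℝ (((k : ℕ) : WithTop ℕ∞) + 1) fun p : ℝ × ℝ => w p.1 p.2 := by rw [← hcast]; exact hw
    have hqc : ContDiff ℝ (((k : ℕ) : WithTop ℕ∞) + 1) fun p : ℝ × ℝ => q p.1 p.2 := by rw [← hcast]; exact hq
    have hT : ContDiff ℝ k fun p : ℝ × ℝ => transportOp q w p.1 p.2 := contDiff_transportOp hwc hqc
    have hTzero : ∀ θ', ∀ ϑ ∉ Ioo a' b', transportOp q w θ' ϑ = 0 := fun θ' ϑ hϑ => transportOp_eq_zero_of_forall hzero θ' hϑ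
    rw [iteratedDeriv_succ', hstep, ih hT (hqc.of_le (by simp)) hTzero θ, Function.iterate_succ_apply]

/-- **THE ITERATED TRANSPORT BOUND**: under the hypotheses of the identity, `|T_qᵏ w(θ,ϑ)| ≤ T` on `[a,b]` ⟹
`‖iteratedDeriv k (θ ↦ ∫_a^b w(θ,ϑ)•g(d(θ,ϑ)) dϑ) θ‖ ≤ T · ∫_a^b ‖g(d(θ,ϑ))‖ dϑ` — the `L¹` norm of the profile along the window, at EVERY order. [folklore] -/
theorem norm_iteratedDeriv_intervalIntegral_smul_comp_transport_le (k : ℕ) (haa' : a < a') (hbb' : b' < b) (hab : a ≤ b)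
    {w : ℝ → ℝ → ℝ} (hw : ContDiff ℝ k fun p : ℝ × ℝ => w p.1 p.2) (hq : ContDiff ℝ k fun p : ℝ × ℝ => q p.1 p.2)
    (hzero : ∀ θ, ∀ ϑ ∉ Ioo a' b', w θ ϑ = 0) (hd : ContDiff ℝ 1 fun p : ℝ × ℝ => d p.1 p.2)
    (hrel : ∀ θ, ∀ ϑ ∈ Icc a b, deriv (fun t : ℝ => d t ϑ) θ = q θ ϑ * deriv (d θ) ϑ)
    {g : ℝ → E} (hg : ContDiff ℝ 1 g) (θ : ℝ) {T : ℝ} (hT : ∀ ϑ ∈ Icc a b, |(transportOp q)^[k] w θ ϑ| ≤ T) :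
    ‖iteratedDeriv k (fun θ : ℝ => ∫ ϑ in a..b, w θ ϑ • g (d θ ϑ)) θ‖ ≤ T * ∫ ϑ in a..b, ‖g (d θ ϑ)‖ := by
  rw [iteratedDeriv_intervalIntegral_smul_comp_transport k haa' hbb' hab hw hq hzero hd hrel hg θ]
  have hdθ : Continuous (d θ) := (hd.comp (contDiff_const.prodMk contDiff_id)).continuous
  have hgc : Continuous fun ϑ => ‖g (d θ ϑ)‖ := (hg.continuous.comp hdθ).norm
  have hTk : Continuous fun ϑ => (transportOp q)^[k] w θ ϑ :=
    (contDiff_iterate_transportOp (m := 0) (k := k) (by simpa using hw) (by simpa using hq)).continuous.comp (continuous_const.prodMk continuous_id)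
  have hT0 : 0 ≤ T := (abs_nonneg _).trans (hT a ⟨le_rfl, hab⟩)
  calc ‖∫ ϑ in a..b, (transportOp q)^[k] w θ ϑ • g (d θ ϑ)‖
      ≤ ∫ ϑ in a..b, ‖(transportOp q)^[k] w θ ϑ • g (d θ ϑ)‖ := intervalIntegral.norm_integral_le_integral_norm hab
    _ ≤ ∫ ϑ in a..b, T * ‖g (d θ ϑ)‖ := by
        refine intervalIntegral.integral_mono_on hab ((hTk.smul (hg.continuous.comp hdθ)).norm.intervalIntegrable a b)
          ((hgc.const_mul T).intervalIntegrable a b) fun ϑ hϑ => ?_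
        rw [norm_smul, Real.norm_eq_abs]
        exact mul_le_mul_of_nonneg_right (hT ϑ hϑ) (norm_nonneg _)
    _ = T * ∫ ϑ in a..b, ‖g (d θ ϑ)‖ := intervalIntegral.integral_const_mul T _

end Iterated

end Summit.HubbardSuperconductivity.HubbardSuperconductivity.Theorems.C4a

end
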